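/-
Copyright (c) 2026 the pub-hodgecm-mathlib formalisation cell (harness21).  Prover seat hodgecm-mathlib-K2Liu-p01 (g0): Track B «K2-LIT»,
#184♮ = hLiu418 = stmt-HodgeConjecture-24832, LEAD F0P6-plan (g10) «SKELETON LANDED K2Liu» (REQUESTS l.72360), file #2 of the
K2_Liu road (planner K2Liu-plan (g0), socket module `Cruxes/HLiu418/Lines/K2_Liu_CurveThetaSigs_U1_PoleInput.lean` 55b207bfd8f4f316); 2026-09-03.
-/
import Literature.NumberTheory.Automorphic.PairLFunctionPolesGLOneBoundaryUnconditional
import Literature.NumberTheory.Automorphic.PairLFunctionPolesGLOneDedekindProofs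
import HarnessLib

/-!
# Crux `HLiu418`, Track B road `K2_Liu` (Liu 2021, Thm. B.4 (1)), unit U1 «POLE INPUT», file #2:
# the pole at `s₀ = 1` of `ζ^S_K(s) · L^S(s, ψ)` (FIRST RUNG of the road)

Cell `hodgecm-mathlib`, crux item hLiu418 = `stmt-HodgeConjecture-24832`, route of record `HCCMUnconditional`; squad K2 ∕ K2Liu,
LEAD F0P6-plan (g10) («M-154j» line-shape ruling; «SKELETON LANDED K2Liu» REQUESTS l.72360), planner K2Liu-plan (g0), prover
K2Liu-p01 (g0).  THEOREMS ONLY (no `def`, no instance, no notation, no named-fact hypothesis, no `sorry`, default heartbeats);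
imports = the two ★ imports of the socket module + HarnessLib; lane `--supports stmt-HodgeConjecture-24832` (count-neutral).

WHAT IS PROVED.  `thetaTypePartialLPole` — statement bytes = the socket
`Summit.HodgeConjecture.HodgeConjecture.Cruxes.HLiu418.K2LiuCurveThetaSigsU1PoleInput.sig_K2LiuThetaTypePartialLPole` VERBATIM:
for a number field `K`, a unitary Hecke character `ψ` of `K` trivial on the diagonally embedded positive reals
(Liu, Def. B.2 «strictly unitary») and a finite set `S` of finite places off which `ψ` is unramified, the partial Euler product
`Z(s) = ∏'_{v ∉ S} [(1 − q_v^{−s}) (1 − ψ(ϖ_v) q_v^{−s})]⁻¹ = ζ^S_K(s) · L^S(s, ψ)` has a genuine pole at `s = 1` approached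
from `Re s > 1`: there are `k ≥ 1` and `c ≠ 0` with `(s − 1)^k Z(s) → c` along `𝓝[Re s > 1] 1`.

PROOF.  On `Re s > 1` both factors are multipliable over `{v ∉ S}` (★ `multipliable_inv_one_sub_residueCard_cpow_neg`; and
`multipliable_inv_one_sub_valueAtUniformizer_mul_cpow` below: `‖ψ(ϖ_v) q_v^{−s}‖ = q_v^{−Re s}` is summable, ★
`summable_residueCard_rpow_neg`, ★ `multipliable_inv_one_sub_of_summable_norm`), so `Z(s) = ζ^S_K(s) · L^S(s, ψ)` there
(Mathlib `Multipliable.tprod_mul`) — and only the values on `{Re s > 1}` matter for the within-filter.  If `ψ = 1` then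
`L^S(s, ψ) = ζ^S_K(s)` and with `k = 2`: `(s − 1)² Z(s) = ((s − 1) ζ^S_K(s))² → c₀² ≠ 0` by the simple pole of the partial
Dedekind zeta function ★ `tendsto_sub_one_mul_tprod_eulerFactor_one_numberField` (Hecke 1917 ∕ Neukirch VII (5.11)).  If `ψ ≠ 1`
then with `k = 1`: `(s − 1) Z(s) = ((s − 1) ζ^S_K(s)) · L^S(s, ψ) → c₀ · c₁ ≠ 0`, where `L^S(s, ψ) → c₁ ≠ 0` as `s → 1`,
`Re s > 1`, is Hecke–Landau on the line in limit form ★ `exists_ne_zero_tendsto_partialHeckeL_of_re_eq_one` at `s₀ = 1`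
(Iwasawa Prop. 4.4 ∕ Tate Thm. 4.4.1, proved in the tree).  This is the GL₁ analysis Liu invokes for θ-type data at
`(n, s₀, μ) = (2, 1, λ⁻¹)` («(a) holds at `s₀ = 1`», proof of Prop. D.4 p. 131 via Thm. B.4 (1)(a) p. 98).

HONEST LABEL.  Count-neutral scaffold file of the K2_Liu road («M-154i» §3∕§4); it retires nothing by itself: `HC_CM` is proved
only modulo the 7 printed citations (2 remaining named inputs: hLiu418 = `stmt-HodgeConjecture-24832`, h413 =
`stmt-HodgeConjecture-24833`) until rung 0 closes.

## References
* [Liu2021] Y. Liu, *Fourier–Jacobi cycles and arithmetic relative trace formula (with an appendix by Chao Li and Yihang Zhu)*,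
  Camb. J. Math. 9 (2021): App. B, Thm. B.4 (1)(a) p. 98; App. D, proof of Prop. D.4 p. 131.
* [NeukirchANT1999] J. Neukirch, *Algebraic Number Theory*, Grundlehren 322 (1999): Ch. VII (5.2), Cor. (5.11) (ii), Prop. (8.1).
* [Iwasawa2019] K. Iwasawa, *Hecke's L-functions* (Princeton lectures 1964), SpringerBriefs (2019): Ch. 4 §4.2 Prop. 4.4.
-/

noncomputable section

open scoped Topology NNReal
open NumberField IsDedekindDomain Filter Complex Set
open Literature.NumberTheory.GaloisRepresentations
open Literature.NumberTheory.Automorphic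

namespace Summit.HodgeConjecture.HodgeConjecture.Cruxes.HLiu418.K2LiuThetaTypePartialLPole

variable {K : Type} [Field K] [NumberField K]

/-- **The `ψ`-partial Euler product off any `S` converges on `Re s > 1`**: for unitary `ψ`,
`∏'_{v ∉ S} (1 − ψ(ϖ_v) q_v^{−s})⁻¹` is multipliable, since `‖ψ(ϖ_v) q_v^{−s}‖ = q_v^{−Re s}`
(★ `HeckeCharacter.norm_valueAtUniformizer_mul_cpow`) is summable over all finite places for `Re s > 1`
(★ `summable_residueCard_rpow_neg`), hence over the subtype, and an absolutely convergent `∏ (1 − a_v)⁻¹` is multipliable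
(★ `multipliable_inv_one_sub_of_summable_norm`).  (The tree's named fact `multipliable_heckeLFunction` indexes by
`{v | ψ unramified at v}`; this is the same estimate over `{v ∉ S}`.) [cite: NeukirchANT1999, Ch. VII Prop. (8.1)] -/
theorem multipliable_inv_one_sub_valueAtUniformizer_mul_cpow {ψ : HeckeCharacter K} (hψ : ψ.IsUnitary)
    (S : Set (HeightOneSpectrum (𝓞 K))) {s : ℂ} (hs : 1 < s.re) :
    Multipliable fun v : {v : HeightOneSpectrum (𝓞 K) // v ∉ S} =>
      (1 - ψ.valueAtUniformizer v.1 * ((v.1.residueCard : ℂ) ^ (-s)))⁻¹ := by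
  refine multipliable_inv_one_sub_of_summable_norm ?_
  simp_rw [HeckeCharacter.norm_valueAtUniformizer_mul_cpow hψ]
  exact (summable_residueCard_rpow_neg hs).comp_injective Subtype.val_injective

/-- **`Z(s) = ζ^S_K(s) · L^S(s, ψ)` on `Re s > 1`**: the partial Euler product of the product of the two local factors splits
as the product of the two partial Euler products (both multipliable there; Mathlib `Multipliable.tprod_mul`). [folklore] -/
theorem tprod_zetaFactor_mul_heckeFactor_eq {ψ : HeckeCharacter K} (hψ : ψ.IsUnitary)
    (S : Set (HeightOneSpectrum (𝓞 K))) {s : ℂ} (hs : 1 < s.re) :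
    ∏' v : {v : HeightOneSpectrum (𝓞 K) // v ∉ S},
        ((1 - ((v.1.residueCard : ℂ) ^ (-s)))⁻¹ *
          (1 - ψ.valueAtUniformizer v.1 * ((v.1.residueCard : ℂ) ^ (-s)))⁻¹) =
      (∏' v : {v : HeightOneSpectrum (𝓞 K) // v ∉ S}, (1 - ((v.1.residueCard : ℂ) ^ (-s)))⁻¹) *
        ∏' v : {v : HeightOneSpectrum (𝓞 K) // v ∉ S},
          (1 - ψ.valueAtUniformizer v.1 * ((v.1.residueCard : ℂ) ^ (-s)))⁻¹ :=
  (multipliable_inv_one_sub_residueCard_cpow_neg S hs).tprod_mul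
    (multipliable_inv_one_sub_valueAtUniformizer_mul_cpow hψ S hs)

/-- `1(ϖ_v) = 1` for the trivial Hecke character (the tree keeps this private in each sibling
`PairLFunctionPolesGLOne{Rat,Dedekind,Boundary}Proofs`; a private copy again). [folklore] -/
private theorem valueAtUniformizer_one_K2Liu (v : HeightOneSpectrum (𝓞 K)) :
    (1 : HeckeCharacter K).valueAtUniformizer v = 1 := by
  rw [HeckeCharacter.valueAtUniformizer, HeckeCharacter.localComponent_apply,
    HeckeCharacter.one_apply, Units.val_one]

/-- **File #2 of the K2_Liu road (socket `sig_K2LiuThetaTypePartialLPole`, statement VERBATIM): the pole at `s₀ = 1` of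
`ζ^S_K(s) · L^S(s, ψ)`.**  For a unitary Hecke character `ψ` of the number field `K`, trivial on the diagonal positive
reals and unramified off the finite set `S` of finite places, there are `k ≥ 1` and `c ≠ 0` with
`(s − 1)^k · ∏'_{v ∉ S} [(1 − q_v^{−s})(1 − ψ(ϖ_v) q_v^{−s})]⁻¹ → c` as `s → 1`, `Re s > 1`
(`k = 2`, `c = c₀²` if `ψ = 1`, by ★ `tendsto_sub_one_mul_tprod_eulerFactor_one_numberField` squared; `k = 1`,
`c = c₀ c₁` if `ψ ≠ 1`, by ★ `tendsto_sub_one_mul_tprod_eulerFactor_one_numberField` times Hecke–Landau in limit form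
★ `exists_ne_zero_tendsto_partialHeckeL_of_re_eq_one` at `s₀ = 1`).  Liu invokes exactly this GL₁ analysis for θ-type
data («(a) holds at `s₀ = 1`»). [cite: Liu2021, Thm. B.4 (1)(a), p. 98] [cite: Liu2021, Prop. D.4 (proof), p. 131]
[cite: NeukirchANT1999, Ch. VII Cor. (5.11) (ii)] [cite: Iwasawa2019, Ch. 4 §4.2 Prop. 4.4] -/
theorem thetaTypePartialLPole :
    ∀ (K : Type) [Field K] [NumberField K] (ψ : HeckeCharacter K), ψ.IsUnitary →
      (∀ t : ℝ≥0ˣ, ψ (posRealIdele K t) = 1) →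
        ∀ (S : Set (HeightOneSpectrum (𝓞 K))), S.Finite → (∀ v ∉ S, ψ.IsUnramifiedAt v) →
          ∃ (k : ℕ) (c : ℂ), 1 ≤ k ∧ c ≠ 0 ∧
            Tendsto (fun s : ℂ => (s - 1) ^ k *
                ∏' v : {v : HeightOneSpectrum (𝓞 K) // v ∉ S},
                  ((1 - ((v.1.residueCard : ℂ) ^ (-s)))⁻¹ *
                    (1 - ψ.valueAtUniformizer v.1 * ((v.1.residueCard : ℂ) ^ (-s)))⁻¹))
              (𝓝[{s : ℂ | 1 < s.re}] 1) (𝓝 c) := by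
  intro K _ _ ψ hu hA S hS hur
  -- the simple pole of the partial Dedekind zeta function `ζ^S_K` at `s = 1`
  obtain ⟨c₀, hc₀, hζ⟩ := tendsto_sub_one_mul_tprod_eulerFactor_one_numberField (K := K) hS
  by_cases h1 : ψ = 1
  · -- `ψ = 1`: `Z = (ζ^S_K)²`, a double pole: `k = 2`, `c = c₀²`
    subst h1
    refine ⟨2, c₀ * c₀, by norm_num, mul_ne_zero hc₀ hc₀, ?_⟩
    refine (hζ.mul hζ).congr' (eventually_nhdsWithin_of_forall fun s hs => ?_)
    have hs' : 1 < s.re := hs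
    dsimp only
    rw [tprod_zetaFactor_mul_heckeFactor_eq hu S hs']
    simp only [valueAtUniformizer_one_K2Liu, one_mul]
    ring
  · -- `ψ ≠ 1`: `Z = ζ^S_K · L^S(·, ψ)` with `L^S(s, ψ) → c₁ ≠ 0` (Hecke–Landau at `s₀ = 1`): `k = 1`, `c = c₀ c₁`
    obtain ⟨c₁, hc₁, hL⟩ :=
      exists_ne_zero_tendsto_partialHeckeL_of_re_eq_one ψ hu hA h1 hS hur (s₀ := 1) Complex.one_re
    refine ⟨1, c₀ * c₁, le_rfl, mul_ne_zero hc₀ hc₁, ?_⟩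
    refine (hζ.mul hL).congr' (eventually_nhdsWithin_of_forall fun s hs => ?_)
    have hs' : 1 < s.re := hs
    dsimp only
    rw [pow_one, tprod_zetaFactor_mul_heckeFactor_eq hu S hs', mul_assoc]

/-- Tie to the socket BY NAME: the statement of `thetaTypePartialLPole` is literally that of
`…Cruxes.HLiu418.K2LiuCurveThetaSigsU1PoleInput.sig_K2LiuThetaTypePartialLPole` (checked here against the verbatim
restatement; the planner re-ties the socket by import in the next module edition). [folklore] -/
example : (∀ (K : Type) [Field K] [NumberField K] (ψ : HeckeCharacter K), ψ.IsUnitary →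
      (∀ t : ℝ≥0ˣ, ψ (posRealIdele K t) = 1) →
        ∀ (S : Set (HeightOneSpectrum (𝓞 K))), S.Finite → (∀ v ∉ S, ψ.IsUnramifiedAt v) →
          ∃ (k : ℕ) (c : ℂ), 1 ≤ k ∧ c ≠ 0 ∧
            Tendsto (fun s : ℂ => (s - 1) ^ k *
                ∏' v : {v : HeightOneSpectrum (𝓞 K) // v ∉ S},
                  ((1 - ((v.1.residueCard : ℂ) ^ (-s)))⁻¹ *
                    (1 - ψ.valueAtUniformizer v.1 * ((v.1.residueCard : ℂ) ^ (-s)))⁻¹))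
              (𝓝[{s : ℂ | 1 < s.re}] 1) (𝓝 c)) :=
  thetaTypePartialLPole

end Summit.HodgeConjecture.HodgeConjecture.Cruxes.HLiu418.K2LiuThetaTypePartialLPole
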